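import Mathlib
import Literature.Probability.RandomPlanarGeometry.PlanarDomains
import Literature.Probability.LatticeModels.DobrushinDiscretisation
import Literature.Probability.LatticeModels.MedialWinding
import Literature.Probability.LatticeModels.MedialExplorationChains
import HarnessLib

/-!
# ParafermionBulkNondegenerate

Topic `Literature/Probability/LatticeModels`. Named literature fact(s) relocated by the gate from `Summits/CriticalPhenomena/CardyFormulaZ2/Theorems/ParafermionPrecompact/Negative/ParafermionPrecompactFalseOfBulkNondegenerate.lean`
(accept-time relocation of `[cite]`d propositions written inline in a Summits proposal; human ruling 2026-08-15).
Sources: DuminilCopinSmirnov2012Lattice.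

* `Literature.Probability.LatticeModels.ParafermionBulkNondegenerate`
-/

namespace Literature.Probability.LatticeModels

open _root_.Literature.Probability.LatticeModels _root_.Literature.Probability.RandomPlanarGeometry
open _root_.Literature.Probability.Percolation _root_.MeasureTheory _root_.Filter _root_.Set
open scoped _root_.Topology

/-- OPEN CONJECTURE — **Bulk non-degeneracy of the `q = 1` parafermionic vertex observable at
the Duminil-Copin–Smirnov scale `δ^{1/3}`** (`H` of the negative lemma on
`CardySusyWard.ParafermionPrecompact`).  STATUS: this proposition is NOT a published theorem.
Its only source, Duminil-Copin–Smirnov, *Conformal invariance of lattice models* (Clay Math.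
Proc. 15, 2012; arXiv:1109.1549), §8.3.1, prints the convergence `(2δ)^{-σ} F_δ(z) → φ′(z)^σ`
(`q ≤ 4`, `σ = 1 − (2/π) arccos(√q/2)`) as **Conjecture 8.7** and says of it "the convergence of
observables is still unproved" and (after Conjecture 8.8) "All other cases [`q ≠ 0, 2`] are wide
open. The `q = 1` case … is actually bond percolation on the square lattice"; the only result
proved there for the `q ≤ 4` observable is Proposition 8.6 (half of the discrete Cauchy–Riemann
relations).  Any proof of the statement below must bound from below, at a medial vertex at
macroscopic distance from `∂Ω`, `‖F_δ(z)‖ ≤ 3·P_{1/2}(z ∈ γ) ≤ 3·π₂(c/δ)` (`π₂` = polychromatic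
two-arm probability of critical bond percolation on `ℤ²`), i.e. it contains the arm-exponent
bound `π₂(n) ≥ c·n^{-1/3}` along a sequence — unproved on `ℤ²` (arm exponents are rigorous only
for site percolation on the triangular lattice) — together with leading-order phase coherence of
`Σ e^{-iW/3}`, which is the content of Conjecture 8.7 itself.  Literature-prover verdict
(2026-08-16, unit `provefact-…Par-c9f9660080`): open-problem; per the conjecture ruling its home
is an `@[conjecture]` obligation under `Summits/CriticalPhenomena/CardyFormulaZ2/Theorems/`
(planner / gate relocation), and routes may use it only as a listed crux or a `conditional_on`.
The Lean statement is unchanged.  For SOME Dobrushin domain `D = (Ω; a, b)`, SOME square-lattice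
discretisation family `Λ` of `D` (the six `ZdDiscretisationFamily` fields, unbundled: vertex set
`meshDomain Ω δ`, mesh `δ`, wired arc → `(ab)`, dual-wired arc → `(ba)` and discrete marks → `{a, b}`
in Hausdorff distance, `IsZdAdmissible` for all small `δ`) and SOME compact `K ⊆ Ω`, the observable
`F_δ(z) = ∫ passageSum (medialExploration (Λ δ) ω) δ (1/3) z dP_{1/2}` is NOT `o(δ^{1/3})` uniformly on
`K`: there is `ε > 0` such that, for `δ → 0⁺` frequently, some medial vertex `z` with
`medialPoint δ z ∈ K` has `‖F_δ(z)‖ > ε δ^{1/3}`.  This is the weakest form of the non-triviality of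
the scaling limit predicted by Duminil-Copin–Smirnov, *Conformal invariance of lattice models*
(2012), Conjecture 8.7 at `q = 1`, `σ = 1/3` (`(2δ)^{-σ} F_δ → (φ′)^σ` uniformly on compacts, `φ` the
conformal map onto the strip `ℝ × (0,1)`, so the limit vanishes nowhere); an OPEN lower bound for
bond percolation on `ℤ²` (the printed a-priori bounds are from above, `‖F_δ‖ ≤ 2 P(z ∈ γ)`).
[cite: DuminilCopinSmirnov2012Lattice, Conjecture 8.7] [status: open] [topic Probability/LatticeModels] -/
def ParafermionBulkNondegenerate : Prop :=
  ∃ (D : _root_.Literature.Probability.RandomPlanarGeometry.DobrushinDomain)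
    (Λ : ℝ → _root_.Literature.Probability.LatticeModels.DiscreteDobrushin),
    ((∀ δ, (Λ δ).Ω = D.carrier) ∧ (∀ δ, (Λ δ).δ = δ) ∧
      _root_.Filter.Tendsto (fun δ : ℝ => _root_.Metric.hausdorffEDist (Λ δ).arcA (D.arc 0))
        (_root_.nhdsWithin (0:ℝ) (_root_.Set.Ioi 0)) (_root_.nhds 0) ∧
      _root_.Filter.Tendsto (fun δ : ℝ => _root_.Metric.hausdorffEDist (Λ δ).arcB (D.arc 1))
        (_root_.nhdsWithin (0:ℝ) (_root_.Set.Ioi 0)) (_root_.nhds 0) ∧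
      _root_.Filter.Tendsto (fun δ : ℝ => _root_.Metric.hausdorffEDist
          (_root_.Literature.Probability.LatticeModels.medialPoint δ '' (Λ δ).zdABEdges)
          {D.pt 0, D.pt 1})
        (_root_.nhdsWithin (0:ℝ) (_root_.Set.Ioi 0)) (_root_.nhds 0) ∧
      _root_.Filter.Eventually (fun δ : ℝ => (Λ δ).IsZdAdmissible)
        (_root_.nhdsWithin (0:ℝ) (_root_.Set.Ioi 0))) ∧
    ∃ K : _root_.Set ℂ, _root_.IsCompact K ∧ K ⊆ D.carrier ∧ ∃ ε : ℝ, 0 < ε ∧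
      _root_.Filter.Frequently (fun δ : ℝ =>
        ∃ z : _root_.Literature.Probability.LatticeModels.MedialVertex,
          _root_.Literature.Probability.LatticeModels.medialPoint δ z ∈ K ∧
            ε * δ ^ ((1:ℝ) / 3) <
              ‖_root_.MeasureTheory.integral
                  (_root_.Literature.Probability.Percolation.bondPercolation
                    (_root_.Literature.Probability.LatticeModels.zdGraph 2)
                    _root_.Literature.Probability.Percolation.half)
                  (fun ω => _root_.Literature.Probability.LatticeModels.MedialPath.passageSum
                    (_root_.Literature.Probability.LatticeModels.medialExploration (Λ δ) ω)
                    δ (1 / 3) z)‖)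
        (_root_.nhdsWithin (0:ℝ) (_root_.Set.Ioi 0))

end Literature.Probability.LatticeModels
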